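import Mathlib.Analysis.SpecialFunctions.Pow.Deriv
import Mathlib.Analysis.SpecialFunctions.Complex.Arg
import Mathlib.Analysis.SpecialFunctions.Exp
import Mathlib.Analysis.SpecialFunctions.Pow.Asymptotics
import Literature.NumberTheory.Transcendental.HypersurfaceCover
import Summits.Schanuel.Schanuel.Theorems.ZilberEacComplexPunctureDecouplingLemmas
import Literature.NumberTheory.Transcendental.ExpVarieties
import Literature.ModelTheory.ExponentialFields.Languages
import Summits.Schanuel.Schanuel.Theorems.ZilberEacComplexEscapeLemmas
import HarnessLib

/-!
# EC by escape to infinity: quadric graph bases with monomial fibres `yⱼ = cⱼ yₙ^{κⱼ} + Aⱼ(x')`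

Variant of `exists_expPoint_quadricEscape_matrix` (`ZilberEacComplexQuadricEscapeMatrix.lean`): over a
quadric graph `x_{s+1} = g(x') = xᵀMx + b·x + c₀` the fibre may depend on the distinguished torus
coordinate through any MONOMIAL, `yⱼ = cⱼ y_{s+1}^{κⱼ} + Aⱼ(x')` (`κⱼ ≥ 1`, `cⱼ ≠ 0`, `Aⱼ` arbitrary),
under the matching non-isotropy condition `κᵀMκ = Σᵢⱼ Mᵢⱼκᵢκⱼ ≠ 0`: escape along `x' ≈ τκ`,
`xⱼ = κⱼτ + log cⱼ + ζⱼ`, `x_{s+1} = τ - 2πiσk`, `τ` the root of `ατ² + (β(v) - 1)τ + (g(v) + 2πiσk) = 0`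
(`α = κᵀMκ`, `β(v) = Σ Mᵢₗ(κᵢvₗ + κₗvᵢ) + b·κ`), `Re τ ≥ √(πk/|α|) - O(1)`, and
`e^{ζⱼ} = 1 + Aⱼ(x)e^{-κⱼτ}/cⱼ` is solved by the contraction lemma
`Literature.NumberTheory.Transcendental.ExpDominant.exists_exp_eq_one_add`. E.g. over Mantova–Masser's
isotropic base `x₃ = x₁² - x₂²` (`κ = (1,1)` fails) the fibres `y₁ = c₁y₃² + A₁`, `y₂ = c₂y₃ + A₂`
(`κ = (2,1)`, `α = 3`) are covered. First open rung of EAC: Mantova–Masser, PLMS 129 (2024), §1 p. 5.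
HONEST FRAMING: a modest new sub-rung of EAC; nothing here bears on Schanuel's conjecture.
-/

noncomputable section

open Complex MvPolynomial Metric Set Filter Topology

set_option linter.dupNamespace false

namespace Summit.Schanuel.Schanuel.Theorems

/-! ### The escape theorem -/

set_option maxHeartbeats 400000 in
/-- **EC by escape to infinity: quadric graph base, monomial fibres.** For `M ∈ ℂ^{s×s}`, `b ∈ ℂˢ`,
`c₀ ∈ ℂ`, positive integers `κⱼ` with `Σᵢⱼ Mᵢⱼκᵢκⱼ ≠ 0`, `cⱼ ∈ ℂˣ` and arbitrary `Aⱼ ∈ ℂ[x₁..xₛ]`, the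
system `exp xⱼ = cⱼ(e^{g(x)})^{κⱼ} + Aⱼ(x)` (`g = xᵀMx + b·x + c₀`, `j ≤ s`) has a solution: the
`(s+1)`-fold `V = {x_{s+1} = g(x'), yⱼ = cⱼ y_{s+1}^{κⱼ} + Aⱼ(x')}` (`dim π₁ V = n - 1`, first open range
of EAC, Mantova–Masser 2024 §1 p. 5) meets the graph of `exp`, with NO lattice-direction hypothesis.
Generalizes `exists_expPoint_quadricEscape_matrix` (`κ = (1,…,1)`). New.
[cite: MantovaMasser2023, §1 p.5 (the open case dim π(V) = 2 in ℂ³×ℂˣ³)] -/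
theorem exists_expPoint_quadricEscape_powers {s : ℕ} (M : Fin s → Fin s → ℂ) (b : Fin s → ℂ) (c₀ : ℂ)
    (κ : Fin s → ℕ) (hκ : ∀ j, 0 < κ j)
    (hα : ∑ i, ∑ j, M i j * (κ i : ℂ) * (κ j : ℂ) ≠ 0)
    (c : Fin s → ℂ) (hc : ∀ j, c j ≠ 0) (A : Fin s → MvPolynomial (Fin s) ℂ) :
    ∃ x : Fin s → ℂ, ∀ j,
      exp (x j) = c j * exp (∑ i, ∑ l, M i l * x i * x l + ∑ i, b i * x i + c₀) ^ (κ j) +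
        eval x (A j) := by
  classical
  set α : ℂ := ∑ i, ∑ j, M i j * (κ i : ℂ) * (κ j : ℂ) with hαdef
  set Kk : ℝ := ∑ j, (κ j : ℝ) with hKk
  have hKk0 : 0 ≤ Kk := by positivity
  have hκK : ∀ j, (κ j : ℝ) ≤ Kk := fun j =>
    Finset.single_le_sum (f := fun j => (κ j : ℝ)) (fun i _ => by positivity) (Finset.mem_univ j)
  have hκ1 : ∀ j, (1 : ℝ) ≤ κ j := fun j => by exact_mod_cast hκ j
  set g : (Fin s → ℂ) → ℂ := fun x => ∑ i, ∑ l, M i l * x i * x l + ∑ i, b i * x i + c₀ with hgdef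
  set ℓ : Fin s → ℂ := fun j => log (c j) with hℓ
  have hexpℓ : ∀ j, exp (ℓ j) = c j := fun j => Complex.exp_log (hc j)
  obtain ⟨σ, hσ, hσre⟩ := exists_sign_re_nonneg α
  set Dσ : ℂ := -(I * σ) / α with hDσ
  have hσabs : |σ| = 1 := by rcases hσ with h | h <;> simp [h]
  have hDσnorm : ‖Dσ‖ = ‖α‖⁻¹ := by
    rw [hDσ, norm_div, norm_neg, norm_mul, Complex.norm_I, Complex.norm_real, Real.norm_eq_abs,
      hσabs, one_mul, one_div]
  have hα0 : 0 < ‖α‖ := norm_pos_iff.mpr hα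
  have hDσpos : 0 < ‖Dσ‖ := by rw [hDσnorm]; positivity
  have hgrowth := fun j =>
    Literature.NumberTheory.Transcendental.HypersurfaceCover.exists_norm_eval_le_pow (A j)
  choose CA hCA NA hCNA using hgrowth
  -- ### the algebraic branch: `v = ℓ + ζ`, `τ = -(β(v)-1)/(2α) + E^{1/2}`
  set βf : (Fin s → ℂ) → ℂ := fun v =>
    ∑ i, ∑ l, M i l * ((κ i : ℂ) * v l + (κ l : ℂ) * v i) + ∑ i, b i * (κ i : ℂ) with hβf
  obtain ⟨B, hB0, hB⟩ : ∃ B : ℝ, 0 ≤ B ∧ ∀ ζ : Fin s → ℂ, ‖ζ‖ ≤ 1 →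
      ‖(βf (ℓ + ζ) - 1) / (2 * α)‖ ≤ B ∧ ‖((βf (ℓ + ζ) - 1) / (2 * α)) ^ 2 - g (ℓ + ζ) / α‖ ≤ B ∧
        ‖ℓ + ζ‖ ≤ B := by
    have hcont1 : Continuous fun ζ : Fin s → ℂ => (βf (ℓ + ζ) - 1) / (2 * α) := by simp only [hβf]; fun_prop
    have hcont2 : Continuous fun ζ : Fin s → ℂ =>
        ((βf (ℓ + ζ) - 1) / (2 * α)) ^ 2 - g (ℓ + ζ) / α := by
      simp only [hβf, hgdef]; fun_prop
    obtain ⟨B₁, hB₁⟩ := (isCompact_closedBall (0 : Fin s → ℂ) 1).exists_bound_of_continuousOn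
      hcont1.continuousOn
    obtain ⟨B₂, hB₂⟩ := (isCompact_closedBall (0 : Fin s → ℂ) 1).exists_bound_of_continuousOn
      hcont2.continuousOn
    refine ⟨max (max B₁ B₂) (‖ℓ‖ + 1), by positivity, fun ζ hζ => ⟨?_, ?_, ?_⟩⟩
    · exact (hB₁ ζ (by rwa [mem_closedBall, dist_zero_right])).trans
        ((le_max_left _ _).trans (le_max_left _ _))
    · exact (hB₂ ζ (by rwa [mem_closedBall, dist_zero_right])).trans
        ((le_max_right _ _).trans (le_max_left _ _))
    · exact ((norm_add_le _ _).trans (by linarith)).trans (le_max_right _ _)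
  -- ### choice of `k`: `CA j (2 + 3B + 2√((2π‖Dσ‖+1)k))^{NA j} e^{-(√(π‖Dσ‖k) - B - 1)} / ‖c j‖ ≤ ε`
  have hε : (0 : ℝ) < 1 / (16 * ((s : ℝ) + 1)) := by positivity
  have hsmall : ∀ j, ∀ᶠ k : ℕ in atTop,
      CA j / ‖c j‖ * (Kk * (2 * B + Real.sqrt ((2 * Real.pi * ‖Dσ‖ + 1) * k)) + B + 1) ^ NA j *
        Real.exp (-(Real.sqrt (Real.pi * ‖Dσ‖ * k) - B - 1)) ≤ 1 / (16 * ((s : ℝ) + 1)) := by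
    intro j
    have hu : Tendsto (fun k : ℕ => Real.sqrt (Real.pi * ‖Dσ‖ * k)) atTop atTop := by
      refine Real.tendsto_sqrt_atTop.comp ?_
      exact tendsto_natCast_atTop_atTop.const_mul_atTop (by positivity)
    set L : ℝ := Kk * (2 * B) + Kk * Real.sqrt ((2 * Real.pi * ‖Dσ‖ + 1) / (Real.pi * ‖Dσ‖)) + B + 1
      with hL
    have hL0 : 0 ≤ L := by positivity
    have hdom : ∀ k : ℕ, Kk * (2 * B + Real.sqrt ((2 * Real.pi * ‖Dσ‖ + 1) * k)) + B + 1 ≤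
        L * (1 + Real.sqrt (Real.pi * ‖Dσ‖ * k)) := by
      intro k
      have h1 : Real.sqrt ((2 * Real.pi * ‖Dσ‖ + 1) * k) =
          Real.sqrt ((2 * Real.pi * ‖Dσ‖ + 1) / (Real.pi * ‖Dσ‖)) * Real.sqrt (Real.pi * ‖Dσ‖ * k) := by
        rw [← Real.sqrt_mul (by positivity)]
        congr 1
        field_simp
      rw [h1]
      have hr0 := Real.sqrt_nonneg ((2 * Real.pi * ‖Dσ‖ + 1) / (Real.pi * ‖Dσ‖))
      have hS0 := Real.sqrt_nonneg (Real.pi * ‖Dσ‖ * k)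
      set r := Real.sqrt ((2 * Real.pi * ‖Dσ‖ + 1) / (Real.pi * ‖Dσ‖))
      set S := Real.sqrt (Real.pi * ‖Dσ‖ * k)
      have hL1 : Kk * (2 * B) + B + 1 ≤ L := by rw [hL]; nlinarith
      have hL2 : Kk * r ≤ L := by rw [hL]; nlinarith
      have h3 : Kk * (2 * B + r * S) + B + 1 = (Kk * (2 * B) + B + 1) + (Kk * r) * S := by ring
      rw [h3]
      nlinarith [mul_le_mul_of_nonneg_right hL2 hS0]
    have hlim := tendsto_one_add_pow_mul_exp_neg (NA j)
    have hlim2 : Tendsto (fun k : ℕ => CA j / ‖c j‖ * L ^ NA j * Real.exp (B + 1) *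
        ((1 + Real.sqrt (Real.pi * ‖Dσ‖ * k)) ^ NA j *
          Real.exp (-Real.sqrt (Real.pi * ‖Dσ‖ * k)))) atTop (𝓝 0) := by
      have := (hlim.comp hu).const_mul (CA j / ‖c j‖ * L ^ NA j * Real.exp (B + 1))
      rw [mul_zero] at this
      exact this
    refine (hlim2.eventually (eventually_le_nhds hε)).mono fun k hk => le_trans ?_ hk
    have hcj : 0 < ‖c j‖ := norm_pos_iff.mpr (hc j)
    have h1 : (Kk * (2 * B + Real.sqrt ((2 * Real.pi * ‖Dσ‖ + 1) * k)) + B + 1) ^ NA j ≤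
        (L * (1 + Real.sqrt (Real.pi * ‖Dσ‖ * k))) ^ NA j :=
      pow_le_pow_left₀ (by positivity) (hdom k) _
    have h2 : Real.exp (-(Real.sqrt (Real.pi * ‖Dσ‖ * k) - B - 1)) =
        Real.exp (B + 1) * Real.exp (-Real.sqrt (Real.pi * ‖Dσ‖ * k)) := by
      rw [← Real.exp_add]; ring_nf
    rw [h2, mul_pow] at *
    have hCA' : 0 ≤ CA j / ‖c j‖ := div_nonneg (hCA j) (norm_nonneg _)
    calc CA j / ‖c j‖ * (Kk * (2 * B + Real.sqrt ((2 * Real.pi * ‖Dσ‖ + 1) * k)) + B + 1) ^ NA j *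
          (Real.exp (B + 1) * Real.exp (-Real.sqrt (Real.pi * ‖Dσ‖ * k)))
        ≤ CA j / ‖c j‖ * (L ^ NA j * (1 + Real.sqrt (Real.pi * ‖Dσ‖ * k)) ^ NA j) *
          (Real.exp (B + 1) * Real.exp (-Real.sqrt (Real.pi * ‖Dσ‖ * k))) := by
          gcongr
      _ = CA j / ‖c j‖ * L ^ NA j * Real.exp (B + 1) *
          ((1 + Real.sqrt (Real.pi * ‖Dσ‖ * k)) ^ NA j *
            Real.exp (-Real.sqrt (Real.pi * ‖Dσ‖ * k))) := by ring
  have hbig : ∀ᶠ k : ℕ in atTop, (B + 1) ^ 2 ≤ Real.pi * ‖Dσ‖ * k ∧ (1 : ℝ) ≤ k :=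
    ((tendsto_natCast_atTop_atTop.const_mul_atTop (mul_pos Real.pi_pos hDσpos)).eventually_ge_atTop
      _).and (tendsto_natCast_atTop_atTop.eventually_ge_atTop 1)
  obtain ⟨k, hk, ⟨hkB2, hk1⟩⟩ := ((eventually_all.2 hsmall).and hbig).exists
  have hkB : 2 * B + 1 ≤ Real.pi * ‖Dσ‖ * k := by nlinarith
  have hk0 : (0 : ℝ) < k := by linarith
  set E : (Fin s → ℂ) → ℂ := fun ζ =>
    ((βf (ℓ + ζ) - 1) / (2 * α)) ^ 2 - (g (ℓ + ζ) + 2 * Real.pi * I * σ * k) / α with hE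
  set τ : (Fin s → ℂ) → ℂ := fun ζ => -((βf (ℓ + ζ) - 1) / (2 * α)) + (E ζ) ^ ((2 : ℂ)⁻¹) with hτ
  set xf : (Fin s → ℂ) → (Fin s → ℂ) := fun ζ j => (κ j : ℂ) * τ ζ + ℓ j + ζ j with hxf
  have hEsplit : ∀ ζ, E ζ = ((2 * Real.pi * k : ℝ) : ℂ) * Dσ +
      (((βf (ℓ + ζ) - 1) / (2 * α)) ^ 2 - g (ℓ + ζ) / α) := by
    intro ζ
    simp only [hE, hDσ]
    push_cast
    field_simp
    ring
  have hest : ∀ ζ : Fin s → ℂ, ‖ζ‖ < 1 →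
      E ζ ∈ slitPlane ∧ Real.sqrt (Real.pi * ‖Dσ‖ * k) - B - 1 ≤ (τ ζ).re ∧
        ‖xf ζ‖ ≤ Kk * (2 * B + Real.sqrt ((2 * Real.pi * ‖Dσ‖ + 1) * k)) + B + 1 - 1 := by
    intro ζ hζ
    obtain ⟨hb1, hb2, hb3⟩ := hB ζ hζ.le
    obtain ⟨hsq, hwre, hre2⟩ := principalSqrt_facts (E ζ)
    set w : ℂ := (E ζ) ^ ((2 : ℂ)⁻¹) with hw
    set R : ℂ := ((βf (ℓ + ζ) - 1) / (2 * α)) ^ 2 - g (ℓ + ζ) / α with hR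
    have hRb : ‖R‖ ≤ B := hb2
    -- `‖E‖ + Re E ≥ 2πk(‖Dσ‖ + Re Dσ) - 2B ≥ 2πk‖Dσ‖ - 2B`
    have hmain : 2 * Real.pi * k * ‖Dσ‖ - 2 * B ≤ ‖E ζ‖ + (E ζ).re := by
      rw [hEsplit ζ]
      have h1 : ‖((2 * Real.pi * k : ℝ) : ℂ) * Dσ + R‖ ≥ 2 * Real.pi * k * ‖Dσ‖ - ‖R‖ := by
        have := norm_sub_norm_le (((2 * Real.pi * k : ℝ) : ℂ) * Dσ) (-R)
        rw [sub_neg_eq_add, norm_neg, norm_mul, Complex.norm_real,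
          Real.norm_of_nonneg (by positivity)] at this
        linarith
      have h2 : (((2 * Real.pi * k : ℝ) : ℂ) * Dσ + R).re = 2 * Real.pi * k * Dσ.re + R.re := by
        rw [Complex.add_re, Complex.re_ofReal_mul]
      have h3 : -‖R‖ ≤ R.re := by have := Complex.abs_re_le_norm R; rw [abs_le] at this; exact this.1
      have h4 : 0 ≤ 2 * Real.pi * k * Dσ.re := by have : 0 ≤ Dσ.re := hσre; positivity
      rw [h2]; linarith
    have hEupp : ‖E ζ‖ ≤ 2 * Real.pi * k * ‖Dσ‖ + B := by
      rw [hEsplit ζ]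
      refine (norm_add_le _ _).trans ?_
      rw [norm_mul, Complex.norm_real, Real.norm_of_nonneg (by positivity)]
      linarith
    have hpos : 0 < ‖E ζ‖ + (E ζ).re := by
      have : 2 * B + 1 ≤ Real.pi * ‖Dσ‖ * k := hkB
      nlinarith
    have hslit : E ζ ∈ slitPlane := by
      rw [mem_slitPlane_iff]
      by_contra hcon
      rw [not_or, not_lt, not_ne_iff] at hcon
      obtain ⟨h1, h2⟩ := hcon
      have : |(E ζ).re| = ‖E ζ‖ := Complex.abs_re_eq_norm.mpr h2
      rw [← this, abs_of_nonpos h1] at hpos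
      linarith
    refine ⟨hslit, ?_, ?_⟩
    · -- `Re τ ≥ Re w - B ≥ √(π‖Dσ‖k) - B - 1`
      have hw2 : Real.pi * ‖Dσ‖ * k - B ≤ w.re ^ 2 := by rw [hre2]; linarith
      have hw3 : Real.sqrt (Real.pi * ‖Dσ‖ * k) - 1 ≤ w.re := by
        by_cases hcase : Real.pi * ‖Dσ‖ * k - B ≤ 0
        · exfalso
          have hP : 2 * B + 1 ≤ Real.pi * ‖Dσ‖ * k := hkB
          linarith
        · rw [not_le] at hcase
          have h1 : Real.sqrt (Real.pi * ‖Dσ‖ * k - B) ≤ w.re := by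
            rw [← Real.sqrt_sq hwre]; exact Real.sqrt_le_sqrt hw2
          -- `√P - 1 ≤ √(P - B)` since `√P ≥ (B+1)/2` (`P ≥ (B+1)²`)
          have hP : 2 * B + 1 ≤ Real.pi * ‖Dσ‖ * k := hkB
          have hsP : (B + 1) / 2 ≤ Real.sqrt (Real.pi * ‖Dσ‖ * k) := by
            rw [Real.le_sqrt (by positivity) (by positivity)]
            nlinarith [hkB2]
          have h2 : Real.sqrt (Real.pi * ‖Dσ‖ * k) - 1 ≤ Real.sqrt (Real.pi * ‖Dσ‖ * k - B) := by
            by_cases hneg : Real.sqrt (Real.pi * ‖Dσ‖ * k) - 1 ≤ 0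
            · exact hneg.trans (Real.sqrt_nonneg _)
            · rw [not_le] at hneg
              rw [Real.le_sqrt hneg.le hcase.le]
              have hss : Real.sqrt (Real.pi * ‖Dσ‖ * k) ^ 2 = Real.pi * ‖Dσ‖ * k :=
                Real.sq_sqrt (by positivity)
              nlinarith
          linarith
      have hτre : (τ ζ).re = -((βf (ℓ + ζ) - 1) / (2 * α)).re + w.re := by
        simp only [hτ, hw, Complex.add_re, Complex.neg_re]
      have h5 : -((βf (ℓ + ζ) - 1) / (2 * α)).re ≥ -B := by
        have := Complex.abs_re_le_norm ((βf (ℓ + ζ) - 1) / (2 * α))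
        rw [abs_le] at this; linarith [this.2]
      rw [hτre]; linarith
    · -- size of `x(ζ)`: `‖τ‖ ≤ B + ‖w‖`, `‖w‖ = √‖E‖ ≤ √(2π‖Dσ‖k + B)`
      have hwn : ‖w‖ ≤ Real.sqrt ((2 * Real.pi * ‖Dσ‖ + 1) * k) + B := by
        have h1 : ‖w‖ ^ 2 = ‖E ζ‖ := by rw [← norm_pow, hsq]
        have h2 : ‖w‖ ≤ Real.sqrt ‖E ζ‖ := by rw [← h1, Real.sqrt_sq (norm_nonneg _)]
        have h3 : Real.sqrt ‖E ζ‖ ≤ Real.sqrt ((2 * Real.pi * ‖Dσ‖ + 1) * k + B ^ 2 + 2 * B *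
            Real.sqrt ((2 * Real.pi * ‖Dσ‖ + 1) * k)) := by
          refine Real.sqrt_le_sqrt (hEupp.trans ?_)
          have := Real.sqrt_nonneg ((2 * Real.pi * ‖Dσ‖ + 1) * k)
          nlinarith
        have h4 : (2 * Real.pi * ‖Dσ‖ + 1) * k + B ^ 2 + 2 * B * Real.sqrt ((2 * Real.pi * ‖Dσ‖ + 1) * k)
            = (Real.sqrt ((2 * Real.pi * ‖Dσ‖ + 1) * k) + B) ^ 2 := by
          rw [add_sq, Real.sq_sqrt (by positivity)]; ring
        rw [h4, Real.sqrt_sq (by positivity)] at h3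
        linarith
      have hτn : ‖τ ζ‖ ≤ 2 * B + Real.sqrt ((2 * Real.pi * ‖Dσ‖ + 1) * k) := by
        calc ‖τ ζ‖ ≤ ‖-((βf (ℓ + ζ) - 1) / (2 * α))‖ + ‖w‖ := norm_add_le _ _
          _ ≤ B + (Real.sqrt ((2 * Real.pi * ‖Dσ‖ + 1) * k) + B) := by rw [norm_neg]; exact add_le_add hb1 hwn
          _ = _ := by ring
      have hsq0 := Real.sqrt_nonneg ((2 * Real.pi * ‖Dσ‖ + 1) * k)
      have hKs : 0 ≤ Kk * (2 * B + Real.sqrt ((2 * Real.pi * ‖Dσ‖ + 1) * k)) :=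
        mul_nonneg hKk0 (by linarith)
      rw [pi_norm_le_iff_of_nonneg (by linarith)]
      intro j
      show ‖(κ j : ℂ) * τ ζ + ℓ j + ζ j‖ ≤ _
      have h6 : ‖ℓ j + ζ j‖ ≤ B := (norm_le_pi_norm (ℓ + ζ) j).trans hb3
      have h7 : ‖(κ j : ℂ) * τ ζ‖ ≤ Kk * (2 * B + Real.sqrt ((2 * Real.pi * ‖Dσ‖ + 1) * k)) := by
        rw [norm_mul, Complex.norm_natCast]
        exact mul_le_mul (hκK j) hτn (norm_nonneg _) hKk0
      calc ‖(κ j : ℂ) * τ ζ + ℓ j + ζ j‖ = ‖(κ j : ℂ) * τ ζ + (ℓ j + ζ j)‖ := by rw [add_assoc]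
        _ ≤ ‖(κ j : ℂ) * τ ζ‖ + ‖ℓ j + ζ j‖ := norm_add_le _ _
        _ ≤ _ := by linarith
  have halg : ∀ ζ, g (xf ζ) = τ ζ - 2 * Real.pi * I * σ * k := by
    intro ζ
    obtain ⟨hsq, -, -⟩ := principalSqrt_facts (E ζ)
    have hsum1 : ∑ i, ∑ l, M i l * ((κ i : ℂ) * τ ζ + ℓ i + ζ i) * ((κ l : ℂ) * τ ζ + ℓ l + ζ l) =
        α * τ ζ ^ 2 +
          (∑ i, ∑ l, M i l * ((κ i : ℂ) * (ℓ l + ζ l) + (κ l : ℂ) * (ℓ i + ζ i))) * τ ζ +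
          ∑ i, ∑ l, M i l * (ℓ i + ζ i) * (ℓ l + ζ l) := by
      have hrow : ∀ i, ∑ l, M i l * ((κ i : ℂ) * τ ζ + ℓ i + ζ i) * ((κ l : ℂ) * τ ζ + ℓ l + ζ l) =
          (∑ l, M i l * (κ i : ℂ) * (κ l : ℂ)) * τ ζ ^ 2 +
            (∑ l, M i l * ((κ i : ℂ) * (ℓ l + ζ l) + (κ l : ℂ) * (ℓ i + ζ i))) * τ ζ +
            ∑ l, M i l * (ℓ i + ζ i) * (ℓ l + ζ l) := by
        intro i
        rw [Finset.sum_mul, Finset.sum_mul, ← Finset.sum_add_distrib, ← Finset.sum_add_distrib]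
        exact Finset.sum_congr rfl fun l _ => by ring
      rw [hαdef, Finset.sum_congr rfl fun i _ => hrow i, Finset.sum_add_distrib, Finset.sum_add_distrib,
        ← Finset.sum_mul, ← Finset.sum_mul]
    have hsum2 : ∑ i, b i * ((κ i : ℂ) * τ ζ + ℓ i + ζ i) =
        (∑ i, b i * (κ i : ℂ)) * τ ζ + ∑ i, b i * (ℓ i + ζ i) := by
      rw [Finset.sum_mul, ← Finset.sum_add_distrib]
      exact Finset.sum_congr rfl fun i _ => by ring
    have hexp : g (xf ζ) = α * τ ζ ^ 2 + βf (ℓ + ζ) * τ ζ + g (ℓ + ζ) := by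
      show (∑ i, ∑ l, M i l * ((κ i : ℂ) * τ ζ + ℓ i + ζ i) * ((κ l : ℂ) * τ ζ + ℓ l + ζ l) +
          ∑ i, b i * ((κ i : ℂ) * τ ζ + ℓ i + ζ i) + c₀) =
        α * τ ζ ^ 2 +
          (∑ i, ∑ l, M i l * ((κ i : ℂ) * (ℓ + ζ) l + (κ l : ℂ) * (ℓ + ζ) i) + ∑ i, b i * (κ i : ℂ)) *
            τ ζ +
          (∑ i, ∑ l, M i l * (ℓ + ζ) i * (ℓ + ζ) l + ∑ i, b i * (ℓ + ζ) i + c₀)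
      simp only [Pi.add_apply]
      rw [hsum1, hsum2]
      ring
    set pp : ℂ := (βf (ℓ + ζ) - 1) / (2 * α) with hpp
    set qq : ℂ := (g (ℓ + ζ) + 2 * Real.pi * I * σ * k) / α with hqq
    have hEpq : E ζ = pp ^ 2 - qq := rfl
    have hτpq : τ ζ = -pp + (E ζ) ^ ((2 : ℂ)⁻¹) := rfl
    have hp' : βf (ℓ + ζ) - 1 = 2 * α * pp := by rw [hpp]; field_simp
    have hq' : g (ℓ + ζ) + 2 * Real.pi * I * σ * k = α * qq := by rw [hqq]; field_simp
    have hquad : α * τ ζ ^ 2 + (βf (ℓ + ζ) - 1) * τ ζ + (g (ℓ + ζ) + 2 * Real.pi * I * σ * k) = 0 := by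
      rw [hp', hq', hτpq]
      have : α * (-pp + (E ζ) ^ ((2 : ℂ)⁻¹)) ^ 2 + 2 * α * pp * (-pp + (E ζ) ^ ((2 : ℂ)⁻¹)) + α * qq =
          α * (((E ζ) ^ ((2 : ℂ)⁻¹)) ^ 2 - (pp ^ 2 - qq)) := by ring
      rw [this, hsq, hEpq, sub_self, mul_zero]
    linear_combination hexp + hquad
  set G : Fin s → (Fin s → ℂ) → ℂ := fun j ζ =>
    eval (xf ζ) (A j) * exp (-((κ j : ℂ) * τ ζ)) * (c j)⁻¹ with hG
  have hGdiff : ∀ j, DifferentiableOn ℂ (G j) (ball 0 1) := by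
    intro j
    have hβd : Differentiable ℂ fun ζ : Fin s → ℂ => (βf (ℓ + ζ) - 1) / (2 * α) := by simp only [hβf]; fun_prop
    have hEd : Differentiable ℂ E := by
      show Differentiable ℂ fun ζ =>
        ((βf (ℓ + ζ) - 1) / (2 * α)) ^ 2 - (g (ℓ + ζ) + 2 * Real.pi * I * σ * k) / α
      simp only [hβf, hgdef]; fun_prop
    have hτd : DifferentiableOn ℂ τ (ball 0 1) := by
      have h1 : DifferentiableOn ℂ (fun ζ => (E ζ) ^ ((2 : ℂ)⁻¹)) (ball 0 1) :=
        hEd.differentiableOn.cpow (differentiableOn_const _) fun ζ hζ =>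
          (hest ζ (by rwa [mem_ball, dist_zero_right] at hζ)).1
      show DifferentiableOn ℂ (fun ζ => -((βf (ℓ + ζ) - 1) / (2 * α)) + (E ζ) ^ ((2 : ℂ)⁻¹)) _
      exact hβd.neg.differentiableOn.add h1
    have hxd : DifferentiableOn ℂ xf (ball 0 1) := by
      refine differentiableOn_pi.2 fun j => ?_
      show DifferentiableOn ℂ (fun ζ => (κ j : ℂ) * τ ζ + ℓ j + ζ j) _
      exact ((hτd.const_mul _).add_const _).add (differentiable_apply j).differentiableOn
    show DifferentiableOn ℂ (fun ζ => eval (xf ζ) (A j) * exp (-((κ j : ℂ) * τ ζ)) * (c j)⁻¹) _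
    exact (((differentiable_mvPolynomial_eval (A j)).comp_differentiableOn hxd).mul
      (hτd.const_mul _).neg.cexp).mul_const _
  have hGb : ∀ j, ∀ ζ ∈ ball (0 : Fin s → ℂ) 1, ‖G j ζ‖ ≤ 1 / (16 * ((s : ℝ) + 1)) := by
    intro j ζ hζ
    rw [mem_ball, dist_zero_right] at hζ
    obtain ⟨-, hre, hxn⟩ := hest ζ hζ
    have hcj : 0 < ‖c j‖ := norm_pos_iff.mpr (hc j)
    have hAx : ‖eval (xf ζ) (A j)‖ ≤
        CA j * (Kk * (2 * B + Real.sqrt ((2 * Real.pi * ‖Dσ‖ + 1) * k)) + B + 1) ^ NA j := by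
      refine (hCNA j _).trans (mul_le_mul_of_nonneg_left ?_ (hCA j))
      exact pow_le_pow_left₀ (by positivity) (by linarith) _
    have hsqB : B + 1 ≤ Real.sqrt (Real.pi * ‖Dσ‖ * k) := by
      rw [Real.le_sqrt (by positivity) (by positivity)]; exact hkB2
    have hτ0 : 0 ≤ (τ ζ).re := by linarith
    have hκre : (τ ζ).re ≤ (κ j : ℝ) * (τ ζ).re := le_mul_of_one_le_left hτ0 (hκ1 j)
    have hex : Real.exp (-((κ j : ℝ) * (τ ζ).re)) ≤
        Real.exp (-(Real.sqrt (Real.pi * ‖Dσ‖ * k) - B - 1)) :=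
      Real.exp_le_exp.mpr (by linarith)
    have hre_mul : (-((κ j : ℂ) * τ ζ)).re = -((κ j : ℝ) * (τ ζ).re) := by simp [Complex.mul_re]
    have hnorm : ‖G j ζ‖ = ‖eval (xf ζ) (A j)‖ * Real.exp (-((κ j : ℝ) * (τ ζ).re)) * ‖c j‖⁻¹ := by
      simp only [hG, norm_mul, norm_inv, Complex.norm_exp, hre_mul]
    rw [hnorm]
    calc ‖eval (xf ζ) (A j)‖ * Real.exp (-((κ j : ℝ) * (τ ζ).re)) * ‖c j‖⁻¹
        ≤ CA j * (Kk * (2 * B + Real.sqrt ((2 * Real.pi * ‖Dσ‖ + 1) * k)) + B + 1) ^ NA j *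
            Real.exp (-(Real.sqrt (Real.pi * ‖Dσ‖ * k) - B - 1)) * ‖c j‖⁻¹ :=
          mul_le_mul_of_nonneg_right (mul_le_mul hAx hex (Real.exp_pos _).le
            (mul_nonneg (hCA j) (pow_nonneg (by
              have := Real.sqrt_nonneg ((2 * Real.pi * ‖Dσ‖ + 1) * k)
              have hKs : 0 ≤ Kk * (2 * B + Real.sqrt ((2 * Real.pi * ‖Dσ‖ + 1) * k)) :=
                mul_nonneg hKk0 (by linarith)
              linarith) _)))
            (inv_nonneg.mpr (norm_nonneg _))
      _ = CA j / ‖c j‖ * (Kk * (2 * B + Real.sqrt ((2 * Real.pi * ‖Dσ‖ + 1) * k)) + B + 1) ^ NA j *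
            Real.exp (-(Real.sqrt (Real.pi * ‖Dσ‖ * k) - B - 1)) := by ring
      _ ≤ _ := hk j
  obtain ⟨ζ, hζ, hfix⟩ := Literature.NumberTheory.Transcendental.ExpDominant.exists_exp_eq_one_add
    G hε.le (le_of_eq (by field_simp : (16 : ℝ) * ((s : ℝ) + 1) * (1 / (16 * ((s : ℝ) + 1))) = 1))
    hGdiff hGb
  refine ⟨xf ζ, fun j => ?_⟩
  have hk1' : exp (-(2 * Real.pi * I * σ * k)) = 1 := by
    rcases hσ with h | h
    · rw [h]
      have h2 := Complex.exp_int_mul_two_pi_mul_I (-(k : ℤ))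
      have h3 : ((-(k : ℤ) : ℤ) : ℂ) * (2 * Real.pi * I) = -(2 * Real.pi * I * ((1 : ℝ) : ℂ) * k) := by
        push_cast; ring
      rwa [h3] at h2
    · rw [h]
      have h2 := Complex.exp_int_mul_two_pi_mul_I (k : ℤ)
      have h3 : ((k : ℤ) : ℂ) * (2 * Real.pi * I) = -(2 * Real.pi * I * ((-1 : ℝ) : ℂ) * k) := by push_cast; ring
      rwa [h3] at h2
  have hgx : exp (∑ i, ∑ l, M i l * xf ζ i * xf ζ l + ∑ i, b i * xf ζ i + c₀) = exp (τ ζ) := by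
    have : (∑ i, ∑ l, M i l * xf ζ i * xf ζ l + ∑ i, b i * xf ζ i + c₀) = g (xf ζ) := rfl
    rw [this, halg, sub_eq_add_neg, Complex.exp_add, hk1', mul_one]
  rw [hgx, ← Complex.exp_nat_mul]
  show exp ((κ j : ℂ) * τ ζ + ℓ j + ζ j) = c j * exp ((κ j : ℂ) * τ ζ) + eval (xf ζ) (A j)
  rw [Complex.exp_add, Complex.exp_add, hexpℓ j, hfix j]
  show exp ((κ j : ℂ) * τ ζ) * c j * (1 + eval (xf ζ) (A j) * exp (-((κ j : ℂ) * τ ζ)) * (c j)⁻¹) =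
    c j * exp ((κ j : ℂ) * τ ζ) + eval (xf ζ) (A j)
  have hee : exp ((κ j : ℂ) * τ ζ) * exp (-((κ j : ℂ) * τ ζ)) = 1 := by
    rw [← Complex.exp_add, add_neg_cancel, Complex.exp_zero]
  have hcj : c j ≠ 0 := hc j
  have hmid : exp ((κ j : ℂ) * τ ζ) * c j *
      (eval (xf ζ) (A j) * exp (-((κ j : ℂ) * τ ζ)) * (c j)⁻¹) = eval (xf ζ) (A j) := by
    calc exp ((κ j : ℂ) * τ ζ) * c j * (eval (xf ζ) (A j) * exp (-((κ j : ℂ) * τ ζ)) * (c j)⁻¹)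
        = eval (xf ζ) (A j) * (exp ((κ j : ℂ) * τ ζ) * exp (-((κ j : ℂ) * τ ζ))) *
            (c j * (c j)⁻¹) := by ring
      _ = eval (xf ζ) (A j) := by rw [hee, mul_inv_cancel₀ hcj]; ring
  rw [mul_add, mul_one, hmid]
  ring

end Summit.Schanuel.Schanuel.Theorems
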